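import Summits.AtomisticToContinuum.BoseEinsteinCondensation.Theorems.BECConjugateDominationShortDistanceCoherence
import Literature.MathematicalPhysics.QuantumManyBody.DiluteBoseGasUpperBoundLocalization
import Mathlib.MeasureTheory.Measure.Lebesgue.EqHaar
import Mathlib.MeasureTheory.Measure.Haar.InnerProductSpace
import HarnessLib

/-!
# Outer pair-shell mass bound, part 2: the annulus estimate in the pair variable
# (line `third-law-current-floor`, crux `HardCoreExtension`, stmt-AtomisticToContinuum-11786; support
# for `stub_pairShellMassBoundV2`, node P4 of the (α') plan)

Analytic half of the outer pair-shell mass bound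
(`BECConjugateDominationHardCoreExtensionPairShellMass.lean`):
* `PairShellMass.lintegral_comp_smul_le` — the linear change of variables `y ↦ μy` in `ℝ³`,
  `∫ f(μy) dy = μ⁻³ ∫ f ≤ 8 ∫ f` for `μ ≥ 1/2` (`MeasureTheory.Measure.map_addHaar_smul`);
* `PairShellMass.nnnorm_sub_sq_le` — FTC + Cauchy–Schwarz along a segment in one particle (as in
  `BECConjugateDominationShortDistanceCoherence.lean`, whose one-dimensional Cauchy–Schwarz lemmas are reused):
  `|Ψ(X + eᵢ⊗r) - Ψ(X)|² ≤ |r|² ∫₀¹ |∇Ψ|²(X + t·eᵢ⊗r) dt` for `C¹` `Ψ : (ℝ³)^N → ℂ`;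
* `PairShellMass.annulus_sq_le` — for `Φ : ℝ³ → ℂ`, `0 < ℓ ≤ a`, `c = a/(a+ℓ)`, a segment bound of
  the above type gives `∫_{a<|y|<a+ℓ} |Φ|² ≤ 16 ∫_{a-ℓ<|y|≤a} |Φ|² + 16 ℓ² ∫_{a-ℓ<|y|<a+ℓ} kk`:
  split `|Φ(y)|² ≤ 2|Φ(cy)|² + 2|Φ(y) - Φ(cy)|²`, scale `z = cy` in the first term and
  `z = (c + t(1-c))y` (after Tonelli) in the second, Jacobians `≤ 8`.
All [folklore]; no named fact is used.
-/

noncomputable section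

namespace Summit.AtomisticToContinuum.BoseEinsteinCondensation.Cruxes.HardCoreExtension.ThirdLawCurrentFloor

open MeasureTheory Filter
open scoped ENNReal NNReal BigOperators Topology
open Literature.MathematicalPhysics.QuantumManyBody.BoseGas

namespace PairShellMass

variable {N : ℕ} {L : ℝ}

/-! ### Annuli -/

/-- The open annulus `{s < |y| < t} ⊂ ℝ³` is measurable. [folklore] -/
theorem measurableSet_annulus_oo (s t : ℝ) : MeasurableSet {y : Space | s < ‖y‖ ∧ ‖y‖ < t} :=
  (measurableSet_lt measurable_const measurable_norm).inter
    (measurableSet_lt measurable_norm measurable_const)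

/-- The half-open annulus `{s < |y| ≤ t} ⊂ ℝ³` is measurable. [folklore] -/
theorem measurableSet_annulus_oc (s t : ℝ) : MeasurableSet {y : Space | s < ‖y‖ ∧ ‖y‖ ≤ t} :=
  (measurableSet_lt measurable_const measurable_norm).inter
    (measurableSet_le measurable_norm measurable_const)

/-! ### The linear change of variables `y ↦ μ y` in `ℝ³` -/

/-- **Scaling in `ℝ³`.** For `f ≥ 0` measurable and `μ ≥ 1/2`, `∫ f(μy) dy = μ⁻³ ∫ f ≤ 8 ∫ f`
(`MeasureTheory.Measure.map_addHaar_smul`). [folklore] -/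
theorem lintegral_comp_smul_le {f : Space → ℝ≥0∞} (hf : Measurable f) {μ : ℝ} (hμ : 1 / 2 ≤ μ) :
    ∫⁻ y, f (μ • y) ≤ 8 * ∫⁻ y, f y := by
  have hμpos : 0 < μ := by linarith
  have h1 : ∫⁻ y, f (μ • y) = ∫⁻ y, f y ∂(Measure.map (fun y : Space ↦ μ • y) volume) := by
    rw [lintegral_map hf (measurable_const_smul μ)]
  rw [h1, Measure.map_addHaar_smul volume hμpos.ne', lintegral_smul_measure]
  refine mul_le_mul_left ?_ _
  have hfin : Module.finrank ℝ Space = 3 := by simp [Space]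
  rw [hfin]
  have hμ3 : (1 / 2 : ℝ) ^ 3 ≤ μ ^ 3 := pow_le_pow_left₀ (by norm_num) hμ 3
  have h8 : |(μ ^ 3)⁻¹| ≤ 8 := by
    rw [abs_of_nonneg (inv_nonneg.2 (by positivity))]
    calc (μ ^ 3)⁻¹ ≤ ((1 / 2 : ℝ) ^ 3)⁻¹ := inv_anti₀ (by norm_num) hμ3
      _ = 8 := by norm_num
  calc ENNReal.ofReal |(μ ^ 3)⁻¹| ≤ ENNReal.ofReal 8 := ENNReal.ofReal_le_ofReal h8
    _ = 8 := by norm_num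

/-! ### The fundamental theorem of calculus along a segment in one particle -/

-- adapted from Summits/AtomisticToContinuum/BoseEinsteinCondensation/Theorems/BECConjugateDominationShortDistanceCoherence.lean
-- (`sdc_single_zero_eq_sum`, `sdc_norm_fderiv_single_sq_le`, `sdc_norm_sub_sq_le`, `sdc_nnnorm_sub_sq_le`:
-- particle `0` ↦ particle `i`, partial gradient ↦ full kinetic density; the two Cauchy–Schwarz lemmas
-- `sdc_sq_integral_unit_le`, `sdc_norm_sum_smul_sq_le` of that file are used as they are)
/-- `eᵢ ⊗ r = ∑ₖ rₖ (eᵢ ⊗ eₖ)` in `(ℝ³)^N`. [folklore] -/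
theorem single_eq_sum_smul (i : Fin N) (r : Space) :
    (Pi.single i r : Config N) =
      ∑ k : Fin 3, r k • (Pi.single i (EuclideanSpace.single k (1 : ℝ)) : Config N) := by
  have hr : r = ∑ k : Fin 3, r k • EuclideanSpace.single k (1 : ℝ) := by
    conv_lhs => rw [← (EuclideanSpace.basisFun (Fin 3) ℝ).sum_repr r]
    refine Finset.sum_congr rfl fun k _ ↦ ?_
    rw [EuclideanSpace.basisFun_apply, EuclideanSpace.basisFun_repr]
  funext m
  rw [Finset.sum_apply]
  by_cases hm : m = i
  · subst hm
    simp only [Pi.single_eq_same, Pi.smul_apply]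
    exact hr
  · simp only [Pi.single_eq_of_ne hm, Pi.smul_apply, smul_zero, Finset.sum_const_zero]

/-- Cauchy–Schwarz over the three axes: `‖DΨ(Z)(eᵢ ⊗ r)‖² ≤ ‖r‖² ∑ₖ ‖DΨ(Z)(eᵢ ⊗ eₖ)‖²`. [folklore] -/
theorem norm_fderiv_single_sq_le (ψ : Config N → ℂ) (Z : Config N) (i : Fin N) (r : Space) :
    ‖fderiv ℝ ψ Z (Pi.single i r)‖ ^ 2 ≤
      ‖r‖ ^ 2 * ∑ k : Fin 3,
        ‖fderiv ℝ ψ Z (Pi.single i (EuclideanSpace.single k (1 : ℝ)))‖ ^ 2 := by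
  rw [single_eq_sum_smul i r, map_sum]
  simp only [map_smul]
  rw [EuclideanSpace.real_norm_sq_eq]
  exact Summit.AtomisticToContinuum.BoseEinsteinCondensation.Theorems.sdc_norm_sum_smul_sq_le _ _ _

/-- **FTC + Cauchy–Schwarz along a segment in particle `i`**:
`‖Ψ(X + eᵢ⊗r) − Ψ(X)‖² ≤ ‖r‖² ∫₀¹ ∑ₖ ‖DΨ(X + t·eᵢ⊗r)(eᵢ ⊗ eₖ)‖² dt` for `C¹` `Ψ`. [folklore] -/
theorem norm_sub_sq_le {ψ : Config N → ℂ} (hψ : ContDiff ℝ 1 ψ) (X : Config N) (i : Fin N)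
    (r : Space) :
    ‖ψ (X + Pi.single i r) - ψ X‖ ^ 2 ≤
      ‖r‖ ^ 2 * ∫ t in (0:ℝ)..1, ∑ k : Fin 3,
        ‖fderiv ℝ ψ (X + t • (Pi.single i r : Config N))
          (Pi.single i (EuclideanSpace.single k (1 : ℝ)))‖ ^ 2 := by
  set e : Config N := Pi.single i r with he
  have hd : Differentiable ℝ ψ := hψ.differentiable one_ne_zero
  have hcf : Continuous (fderiv ℝ ψ) := hψ.continuous_fderiv one_ne_zero
  have hpath : Continuous fun t : ℝ ↦ X + t • e :=
    continuous_const.add (continuous_id.smul continuous_const)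
  have hγ : ∀ t : ℝ, HasDerivAt (fun s : ℝ ↦ X + s • e) e t := fun t ↦ by
    have h := ((hasDerivAt_id t).smul_const e).const_add X
    simpa using h
  set φ : ℝ → ℂ := fun t ↦ fderiv ℝ ψ (X + t • e) e with hφ
  have hderiv : ∀ t : ℝ, HasDerivAt (fun s : ℝ ↦ ψ (X + s • e)) (φ t) t := fun t ↦
    (hd (X + t • e)).hasFDerivAt.comp_hasDerivAt t (hγ t)
  have hφc : Continuous φ := (hcf.comp hpath).clm_apply continuous_const
  have hftc : ∫ t in (0:ℝ)..1, φ t = ψ (X + e) - ψ X := by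
    have h := intervalIntegral.integral_eq_sub_of_hasDerivAt (fun t _ ↦ hderiv t)
      (hφc.intervalIntegrable 0 1)
    simpa using h
  set g : ℝ → ℝ := fun t ↦ ∑ k : Fin 3,
    ‖fderiv ℝ ψ (X + t • e) (Pi.single i (EuclideanSpace.single k (1 : ℝ)))‖ ^ 2 with hg
  have hgc : Continuous g :=
    continuous_finsetSum _ fun k _ ↦ ((hcf.comp hpath).clm_apply continuous_const).norm.pow 2
  have hpt : ∀ t, ‖φ t‖ ^ 2 ≤ ‖r‖ ^ 2 * g t := fun t ↦
    norm_fderiv_single_sq_le ψ (X + t • e) i r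
  calc ‖ψ (X + e) - ψ X‖ ^ 2 = ‖∫ t in (0:ℝ)..1, φ t‖ ^ 2 := by rw [hftc]
    _ ≤ (∫ t in (0:ℝ)..1, ‖φ t‖) ^ 2 :=
        pow_le_pow_left₀ (norm_nonneg _)
          (intervalIntegral.norm_integral_le_integral_norm zero_le_one) 2
    _ ≤ ∫ t in (0:ℝ)..1, ‖φ t‖ ^ 2 :=
        Summit.AtomisticToContinuum.BoseEinsteinCondensation.Theorems.sdc_sq_integral_unit_le hφc.norm
    _ ≤ ∫ t in (0:ℝ)..1, ‖r‖ ^ 2 * g t :=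
        intervalIntegral.integral_mono_on zero_le_one ((hφc.norm.pow 2).intervalIntegrable _ _)
          ((continuous_const.mul hgc).intervalIntegrable _ _) fun t _ ↦ hpt t
    _ = ‖r‖ ^ 2 * ∫ t in (0:ℝ)..1, g t := intervalIntegral.integral_const_mul _ _

/-- The same bound in `ℝ≥0∞` against the full kinetic density:
`‖Ψ(X + eᵢ⊗r) − Ψ(X)‖₊² ≤ ‖r‖² ∫_{(0,1]} |∇Ψ|²(X + t·eᵢ⊗r) dt`. [folklore] -/
theorem nnnorm_sub_sq_le {ψ : Config N → ℂ} (hψ : ContDiff ℝ 1 ψ) (X : Config N) (i : Fin N)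
    (r : Space) :
    ((‖ψ (X + Pi.single i r) - ψ X‖₊ : ℝ≥0∞) ^ 2) ≤
      ENNReal.ofReal (‖r‖ ^ 2) *
        ∫⁻ t in Set.Ioc (0:ℝ) 1, kineticDensity ψ (X + t • (Pi.single i r : Config N)) := by
  set e : Config N := Pi.single i r with he
  have hcf : Continuous (fderiv ℝ ψ) := hψ.continuous_fderiv one_ne_zero
  have hpath : Continuous fun t : ℝ ↦ X + t • e :=
    continuous_const.add (continuous_id.smul continuous_const)
  set g : ℝ → ℝ := fun t ↦ ∑ k : Fin 3,
    ‖fderiv ℝ ψ (X + t • e) (Pi.single i (EuclideanSpace.single k (1 : ℝ)))‖ ^ 2 with hg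
  have hgc : Continuous g :=
    continuous_finsetSum _ fun k _ ↦ ((hcf.comp hpath).clm_apply continuous_const).norm.pow 2
  have hg0 : ∀ t, 0 ≤ g t := fun t ↦ Finset.sum_nonneg fun k _ ↦ sq_nonneg _
  have hgE : ∀ t, ENNReal.ofReal (g t) ≤ kineticDensity ψ (X + t • e) := by
    intro t
    have h1 : ENNReal.ofReal (g t) = ∑ k : Fin 3,
        ((‖fderiv ℝ ψ (X + t • e) (Pi.single i (EuclideanSpace.single k (1 : ℝ)))‖₊ : ℝ≥0∞) ^ 2) := by
      simp only [hg]
      rw [ENNReal.ofReal_sum_of_nonneg (fun k _ ↦ sq_nonneg _)]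
      refine Finset.sum_congr rfl fun k _ ↦ ?_
      rw [ENNReal.ofReal_pow (norm_nonneg _), ofReal_norm, enorm_eq_nnnorm]
    rw [h1, kineticDensity]
    exact Finset.single_le_sum (f := fun i' : Fin N ↦ ∑ k : Fin 3,
      ((‖fderiv ℝ ψ (X + t • e) (Pi.single i' (EuclideanSpace.single k (1 : ℝ)))‖₊ : ℝ≥0∞) ^ 2))
      (fun _ _ ↦ zero_le) (Finset.mem_univ i)
  have h := norm_sub_sq_le hψ X i r
  calc ((‖ψ (X + e) - ψ X‖₊ : ℝ≥0∞) ^ 2) = ENNReal.ofReal (‖ψ (X + e) - ψ X‖ ^ 2) := by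
        rw [ENNReal.ofReal_pow (norm_nonneg _), ofReal_norm, enorm_eq_nnnorm]
    _ ≤ ENNReal.ofReal (‖r‖ ^ 2 * ∫ t in (0:ℝ)..1, g t) := ENNReal.ofReal_le_ofReal h
    _ = ENNReal.ofReal (‖r‖ ^ 2) * ENNReal.ofReal (∫ t in Set.Ioc (0:ℝ) 1, g t) := by
        rw [ENNReal.ofReal_mul (sq_nonneg _), intervalIntegral.integral_of_le zero_le_one]
    _ = ENNReal.ofReal (‖r‖ ^ 2) * ∫⁻ t in Set.Ioc (0:ℝ) 1, ENNReal.ofReal (g t) := by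
        rw [ofReal_integral_eq_lintegral_ofReal hgc.integrableOn_Ioc (ae_of_all _ hg0)]
    _ ≤ ENNReal.ofReal (‖r‖ ^ 2) * ∫⁻ t in Set.Ioc (0:ℝ) 1, kineticDensity ψ (X + t • e) :=
        mul_le_mul_right (lintegral_mono fun t ↦ hgE t) _

/-! ### The annulus estimate in the pair variable -/

/-- **The annulus estimate.** Let `Φ : ℝ³ → ℂ` be measurable, `kk ≥ 0` measurable, `0 < ℓ ≤ a`,
`c = a/(a+ℓ)`, and suppose the segment bound
`‖Φ(y) - Φ(cy)‖₊² ≤ ((1-c)|y|)² ∫_{(0,1]} kk((c + t(1-c))y) dt` for every `y`. Then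
`∫_{a<|y|<a+ℓ} |Φ|² ≤ 16 ∫_{a-ℓ<|y|≤a} |Φ|² + 16 ℓ² ∫_{a-ℓ<|y|<a+ℓ} kk`: split
`|Φ(y)|² ≤ 2|Φ(cy)|² + 2|Φ(y) - Φ(cy)|²`, scale `z = cy ∈ {a-ℓ<|z|≤a}` in the first term and
`z = (c + t(1-c))y ∈ {a-ℓ<|z|<a+ℓ}` (after Tonelli) in the second, Jacobians `≤ 8`. [folklore] -/
theorem annulus_sq_le {Φ : Space → ℂ} (hΦ : Measurable Φ) {kk : Space → ℝ≥0∞} (hkk : Measurable kk)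
    {a ℓ : ℝ} (ha : 0 < a) (hℓ : 0 < ℓ) (hℓa : ℓ ≤ a)
    (H : ∀ y : Space, ((‖Φ y - Φ ((a / (a + ℓ)) • y)‖₊ : ℝ≥0∞) ^ 2) ≤
      ENNReal.ofReal (((1 - a / (a + ℓ)) * ‖y‖) ^ 2) *
        ∫⁻ t in Set.Ioc (0:ℝ) 1, kk ((a / (a + ℓ) + t * (1 - a / (a + ℓ))) • y)) :
    ∫⁻ y in {y : Space | a < ‖y‖ ∧ ‖y‖ < a + ℓ}, ((‖Φ y‖₊ : ℝ≥0∞) ^ 2) ≤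
      16 * (∫⁻ y in {y : Space | a - ℓ < ‖y‖ ∧ ‖y‖ ≤ a}, ((‖Φ y‖₊ : ℝ≥0∞) ^ 2)) +
      16 * ENNReal.ofReal (ℓ ^ 2) * (∫⁻ y in {y : Space | a - ℓ < ‖y‖ ∧ ‖y‖ < a + ℓ}, kk y) := by
  set c : ℝ := a / (a + ℓ) with hc
  set O : Set Space := {y : Space | a < ‖y‖ ∧ ‖y‖ < a + ℓ}
  set I : Set Space := {y : Space | a - ℓ < ‖y‖ ∧ ‖y‖ ≤ a} with hI
  set F : Set Space := {y : Space | a - ℓ < ‖y‖ ∧ ‖y‖ < a + ℓ} with hF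
  have haℓ : 0 < a + ℓ := by linarith
  have hc0 : 0 < c := div_pos ha haℓ
  have hc1 : c ≤ 1 := (div_le_one haℓ).2 (by linarith)
  have hc2 : 1 / 2 ≤ c := by
    rw [hc, div_le_div_iff₀ (by norm_num) haℓ]; linarith
  have hca : c * (a + ℓ) = a := div_mul_cancel₀ _ haℓ.ne'
  have hcℓ : (1 - c) * (a + ℓ) = ℓ := by rw [sub_mul, hca, one_mul]; ring
  have hcaℓ : a - ℓ ≤ c * a := by
    rw [hc, div_mul_eq_mul_div, le_div_iff₀ haℓ]; nlinarith
  -- measurability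
  have hOm : MeasurableSet O := measurableSet_annulus_oo a (a + ℓ)
  have hIm : MeasurableSet I := measurableSet_annulus_oc (a - ℓ) a
  have hFm : MeasurableSet F := measurableSet_annulus_oo (a - ℓ) (a + ℓ)
  have hΦ2 : Measurable fun y ↦ ((‖Φ y‖₊ : ℝ≥0∞) ^ 2) := hΦ.nnnorm.coe_nnreal_ennreal.pow_const 2
  -- where the scaled points land
  have hmemI : ∀ y ∈ O, c • y ∈ I := by
    intro y hy
    simp only [hI, Set.mem_setOf_eq, norm_smul, Real.norm_eq_abs, abs_of_pos hc0]
    constructor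
    · calc a - ℓ ≤ c * a := hcaℓ
        _ < c * ‖y‖ := mul_lt_mul_of_pos_left hy.1 hc0
    · calc c * ‖y‖ ≤ c * (a + ℓ) := mul_le_mul_of_nonneg_left hy.2.le hc0.le
        _ = a := hca
  have hmemF : ∀ t ∈ Set.Ioc (0:ℝ) 1, ∀ y ∈ O, (c + t * (1 - c)) • y ∈ F := by
    intro t ht y hy
    have hμ1 : c ≤ c + t * (1 - c) := le_add_of_nonneg_right (mul_nonneg ht.1.le (by linarith))
    have hμ2 : c + t * (1 - c) ≤ 1 := by nlinarith [ht.2, hc1, ht.1]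
    have hμ0 : 0 < c + t * (1 - c) := hc0.trans_le hμ1
    simp only [hF, Set.mem_setOf_eq, norm_smul, Real.norm_eq_abs, abs_of_pos hμ0]
    constructor
    · calc a - ℓ ≤ c * a := hcaℓ
        _ < c * ‖y‖ := mul_lt_mul_of_pos_left hy.1 hc0
        _ ≤ (c + t * (1 - c)) * ‖y‖ := mul_le_mul_of_nonneg_right hμ1 (norm_nonneg _)
    · calc (c + t * (1 - c)) * ‖y‖ ≤ 1 * ‖y‖ := mul_le_mul_of_nonneg_right hμ2 (norm_nonneg _)
        _ = ‖y‖ := one_mul _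
        _ < a + ℓ := hy.2
  -- pointwise splitting `|Φ y|² ≤ 2|Φ(cy)|² + 2|Φ y - Φ(cy)|²`
  have hsplit : ∀ y, ((‖Φ y‖₊ : ℝ≥0∞) ^ 2) ≤
      2 * ((‖Φ (c • y)‖₊ : ℝ≥0∞) ^ 2) + 2 * ((‖Φ y - Φ (c • y)‖₊ : ℝ≥0∞) ^ 2) := by
    intro y
    have hr : ‖Φ y‖ ^ 2 ≤ 2 * ‖Φ (c • y)‖ ^ 2 + 2 * ‖Φ y - Φ (c • y)‖ ^ 2 := by
      have h1 : ‖Φ y‖ ≤ ‖Φ (c • y)‖ + ‖Φ y - Φ (c • y)‖ := by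
        calc ‖Φ y‖ = ‖Φ (c • y) + (Φ y - Φ (c • y))‖ := by rw [add_sub_cancel]
          _ ≤ _ := norm_add_le _ _
      nlinarith [h1, norm_nonneg (Φ y), norm_nonneg (Φ (c • y)), norm_nonneg (Φ y - Φ (c • y)),
        sq_nonneg (‖Φ (c • y)‖ - ‖Φ y - Φ (c • y)‖)]
    have e : ∀ z : ℂ, ((‖z‖₊ : ℝ≥0∞) ^ 2) = ENNReal.ofReal (‖z‖ ^ 2) := fun z ↦ by
      rw [ENNReal.ofReal_pow (norm_nonneg _), ofReal_norm, enorm_eq_nnnorm]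
    rw [e, e, e]
    calc ENNReal.ofReal (‖Φ y‖ ^ 2)
        ≤ ENNReal.ofReal (2 * ‖Φ (c • y)‖ ^ 2 + 2 * ‖Φ y - Φ (c • y)‖ ^ 2) :=
          ENNReal.ofReal_le_ofReal hr
      _ = _ := by
          rw [ENNReal.ofReal_add (by positivity) (by positivity), ENNReal.ofReal_mul zero_le_two,
            ENNReal.ofReal_mul zero_le_two, ENNReal.ofReal_ofNat]
  -- first term: scale into the inner layer
  have hT1 : ∫⁻ y in O, ((‖Φ (c • y)‖₊ : ℝ≥0∞) ^ 2) ≤ 8 * ∫⁻ y in I, ((‖Φ y‖₊ : ℝ≥0∞) ^ 2) := by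
    calc ∫⁻ y in O, ((‖Φ (c • y)‖₊ : ℝ≥0∞) ^ 2)
        = ∫⁻ y, O.indicator (fun y ↦ ((‖Φ (c • y)‖₊ : ℝ≥0∞) ^ 2)) y :=
          (lintegral_indicator hOm _).symm
      _ ≤ ∫⁻ y, I.indicator (fun z ↦ ((‖Φ z‖₊ : ℝ≥0∞) ^ 2)) (c • y) := by
          refine lintegral_mono fun y ↦ ?_
          by_cases hy : y ∈ O
          · rw [Set.indicator_of_mem hy, Set.indicator_of_mem (hmemI y hy)]
          · rw [Set.indicator_of_notMem hy]; exact zero_le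
      _ ≤ 8 * ∫⁻ y, I.indicator (fun z ↦ ((‖Φ z‖₊ : ℝ≥0∞) ^ 2)) y :=
          lintegral_comp_smul_le (hΦ2.indicator hIm) hc2
      _ = 8 * ∫⁻ y in I, ((‖Φ y‖₊ : ℝ≥0∞) ^ 2) := by rw [lintegral_indicator hIm]
  -- second term: segment bound, Tonelli, scale into the two-sided layer
  have hker : Measurable fun p : Space × ℝ ↦ kk ((c + p.2 * (1 - c)) • p.1) :=
    hkk.comp ((continuous_const.add (continuous_snd.mul continuous_const)).smul continuous_fst).measurable
  have hT2 : ∫⁻ y in O, ((‖Φ y - Φ (c • y)‖₊ : ℝ≥0∞) ^ 2) ≤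
      8 * ENNReal.ofReal (ℓ ^ 2) * ∫⁻ y in F, kk y := by
    calc ∫⁻ y in O, ((‖Φ y - Φ (c • y)‖₊ : ℝ≥0∞) ^ 2)
        ≤ ∫⁻ y in O, ENNReal.ofReal (ℓ ^ 2) * ∫⁻ t in Set.Ioc (0:ℝ) 1, kk ((c + t * (1 - c)) • y) := by
          refine setLIntegral_mono' hOm fun y hy ↦ (H y).trans (mul_le_mul_left ?_ _)
          refine ENNReal.ofReal_le_ofReal ?_
          have h0 : 0 ≤ (1 - c) * ‖y‖ := mul_nonneg (by linarith) (norm_nonneg _)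
          have h1 : (1 - c) * ‖y‖ ≤ ℓ := by
            calc (1 - c) * ‖y‖ ≤ (1 - c) * (a + ℓ) := mul_le_mul_of_nonneg_left hy.2.le (by linarith)
              _ = ℓ := hcℓ
          exact pow_le_pow_left₀ h0 h1 2
      _ = ENNReal.ofReal (ℓ ^ 2) * ∫⁻ y in O, ∫⁻ t in Set.Ioc (0:ℝ) 1, kk ((c + t * (1 - c)) • y) :=
          lintegral_const_mul' _ _ ENNReal.ofReal_ne_top
      _ = ENNReal.ofReal (ℓ ^ 2) * ∫⁻ t in Set.Ioc (0:ℝ) 1, ∫⁻ y in O, kk ((c + t * (1 - c)) • y) := by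
          congr 1
          exact lintegral_lintegral_swap hker.aemeasurable
      _ ≤ ENNReal.ofReal (ℓ ^ 2) * ∫⁻ t in Set.Ioc (0:ℝ) 1, 8 * ∫⁻ y in F, kk y := by
          refine mul_le_mul_right (setLIntegral_mono' measurableSet_Ioc fun t ht ↦ ?_) _
          calc ∫⁻ y in O, kk ((c + t * (1 - c)) • y)
              = ∫⁻ y, O.indicator (fun y ↦ kk ((c + t * (1 - c)) • y)) y :=
                (lintegral_indicator hOm _).symm
            _ ≤ ∫⁻ y, F.indicator kk ((c + t * (1 - c)) • y) := by
                refine lintegral_mono fun y ↦ ?_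
                by_cases hy : y ∈ O
                · rw [Set.indicator_of_mem hy, Set.indicator_of_mem (hmemF t ht y hy)]
                · rw [Set.indicator_of_notMem hy]; exact zero_le
            _ ≤ 8 * ∫⁻ y, F.indicator kk y :=
                lintegral_comp_smul_le (hkk.indicator hFm)
                  (hc2.trans (le_add_of_nonneg_right (mul_nonneg ht.1.le (by linarith))))
            _ = 8 * ∫⁻ y in F, kk y := by rw [lintegral_indicator hFm]
      _ = 8 * ENNReal.ofReal (ℓ ^ 2) * ∫⁻ y in F, kk y := by
          rw [setLIntegral_const, Real.volume_Ioc, sub_zero, ENNReal.ofReal_one, mul_one]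
          ring
  -- assemble
  have hm1 : Measurable fun y ↦ ((‖Φ (c • y)‖₊ : ℝ≥0∞) ^ 2) := hΦ2.comp (measurable_const_smul c)
  have hm2 : Measurable fun y ↦ ((‖Φ y - Φ (c • y)‖₊ : ℝ≥0∞) ^ 2) :=
    (hΦ.sub (hΦ.comp (measurable_const_smul c))).nnnorm.coe_nnreal_ennreal.pow_const 2
  calc ∫⁻ y in O, ((‖Φ y‖₊ : ℝ≥0∞) ^ 2)
      ≤ ∫⁻ y in O, (2 * ((‖Φ (c • y)‖₊ : ℝ≥0∞) ^ 2) + 2 * ((‖Φ y - Φ (c • y)‖₊ : ℝ≥0∞) ^ 2)) :=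
        lintegral_mono fun y ↦ hsplit y
    _ = 2 * (∫⁻ y in O, ((‖Φ (c • y)‖₊ : ℝ≥0∞) ^ 2)) +
          2 * (∫⁻ y in O, ((‖Φ y - Φ (c • y)‖₊ : ℝ≥0∞) ^ 2)) := by
        rw [lintegral_add_left (hm1.const_mul 2), lintegral_const_mul 2 hm1, lintegral_const_mul 2 hm2]
    _ ≤ 2 * (8 * ∫⁻ y in I, ((‖Φ y‖₊ : ℝ≥0∞) ^ 2)) +
          2 * (8 * ENNReal.ofReal (ℓ ^ 2) * ∫⁻ y in F, kk y) := by
        gcongr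
    _ = 16 * (∫⁻ y in I, ((‖Φ y‖₊ : ℝ≥0∞) ^ 2)) + 16 * ENNReal.ofReal (ℓ ^ 2) * (∫⁻ y in F, kk y) := by
        ring

end PairShellMass

open PairShellMass in
/-- **`stub_pairShellMassAnnulus`** (registered sub-goal of `stub_pairShellMassBoundV2`, line
`third-law-current-floor`): the annulus estimate `PairShellMass.annulus_sq_le` in closed form — for
measurable `Φ : ℝ³ → ℂ`, `kk ≥ 0`, `0 < ℓ ≤ a`, `c = a/(a+ℓ)` and the segment bound
`‖Φ(y) - Φ(cy)‖₊² ≤ ((1-c)|y|)² ∫_{(0,1]} kk((c + t(1-c))y) dt`,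
`∫_{a<|y|<a+ℓ} |Φ|² ≤ 16 ∫_{a-ℓ<|y|≤a} |Φ|² + 16 ℓ² ∫_{a-ℓ<|y|<a+ℓ} kk`. [folklore] -/
theorem stub_pairShellMassAnnulus :
    ∀ (a ℓ : ℝ), 0 < a → 0 < ℓ → ℓ ≤ a → ∀ (Φ : Space → ℂ) (kk : Space → ℝ≥0∞), Measurable Φ → Measurable kk →
      (∀ y : Space, ((‖Φ y - Φ ((a / (a + ℓ)) • y)‖₊ : ℝ≥0∞) ^ 2) ≤
        ENNReal.ofReal (((1 - a / (a + ℓ)) * ‖y‖) ^ 2) *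
          ∫⁻ t in Set.Ioc (0:ℝ) 1, kk ((a / (a + ℓ) + t * (1 - a / (a + ℓ))) • y)) →
      ∫⁻ y in {y : Space | a < ‖y‖ ∧ ‖y‖ < a + ℓ}, ((‖Φ y‖₊ : ℝ≥0∞) ^ 2) ≤
        16 * (∫⁻ y in {y : Space | a - ℓ < ‖y‖ ∧ ‖y‖ ≤ a}, ((‖Φ y‖₊ : ℝ≥0∞) ^ 2)) +
          16 * ENNReal.ofReal (ℓ ^ 2) * ∫⁻ y in {y : Space | a - ℓ < ‖y‖ ∧ ‖y‖ < a + ℓ}, kk y :=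
  fun _ _ ha hℓ hℓa _ _ hΦ hkk H ↦ annulus_sq_le hΦ hkk ha hℓ hℓa H

end Summit.AtomisticToContinuum.BoseEinsteinCondensation.Cruxes.HardCoreExtension.ThirdLawCurrentFloor

end
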